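/-
# Shielding: the quantitative form of Blaschke–Borel rigidity — PART B (§§4–5) — CARVE of OBJECT #6 for the ≤ 400-line tree norm

(rh-split cell, author seat rh-split-screw-bridge g18, 2026-08-28; card `cards/SPLIT-screw-bridge.md` §23 «SHIELDING», census V121;
referee rh-split-ref-2 g7 §23 PASS; carved by rh-split-typer-2 g7, lead RULINGS #413/#416.)  Nothing in this file is a claim about the
truth of RH.
-/
import Summits.RiemannHypothesis.RiemannHypothesis.Theorems.Splittings.ScrewBlaschkeShieldingA

/-!
# Part B — moment form of the charge–shielding law, the polygon tower, the shielding exponent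

## CARVE NOTE (rh-split-typer-2 g7, lane «SHIELDING», lead RULINGS #413/#416, 2026-08-28)

PART B = §§4–5 (`shield_mul_charge_le_tail_of_moments`, `tower_shielding`, `shieldExp`, `tail_gt_of_shielded`) of the frozen object
`HOME/rh-split-screw-bridge/g18/ScrewBlaschkeShielding.lean` (sha16 42c937ecda46d634, 497 lines; author seat rh-split-screw-bridge g18),
cut at the declaration boundary before the section header «## 4.» (source l.298) because tree files with proofs are ≤ 400 lines:
source lines 298–497 are reproduced BYTE-IDENTICALLY below, the preamble (`noncomputable section`, options, `open`s, `namespace`) is the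
source's ll.49–58 verbatim; PART A (`Splittings/ScrewBlaschkeShieldingA.lean`: module docstring + §§1–3) is imported and the namespace
`…Theorems.Splittings.ScrewBlaschkeShielding` re-opened, so every fully-qualified name is unchanged and OBJECT #7
(`ScrewShieldingSeam.lean`, `import …ScrewBlaschkeShielding`) needs no edit.  No statement, proof or docstring byte of any
declaration was changed.  The module docstring of record (THE INEQUALITY / UNSHIELDED POINTS CARRY NO CHARGE / THE LAW / THE TOWER /
THE EXPONENT) is in PART A.  Nothing here bears on the truth of RH.
-/


noncomputable section

set_option linter.dupNamespace false

open Complex Metric Set Filter Topology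
open scoped Real ComplexConjugate
open Summit.RiemannHypothesis.RiemannHypothesis.Theorems.Splittings
open Summit.RiemannHypothesis.RiemannHypothesis.Theorems.Splittings.ScrewBlaschkeRigidity

namespace Summit.RiemannHypothesis.RiemannHypothesis.Theorems.Splittings.ScrewBlaschkeShielding

/-! ## 4. Moment form: the law for moment-cancelling families, and the polygon tower -/

/-- **Charge–shielding law, moment form.**  A countable family `w i` in the open unit disc with absolutely
summable charges `b i` and vanishing holomorphic moments `Σ b i w i^k = 0` (`k ≥ 1`) — the shape of the
tree's lattice-blind data — obeys, for every point `a` and every finite `F`: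
`Π_{i∈F} ‖bl (w i) a‖ · ‖a‖ · ‖Σ_{w i = a} b i‖ ≤ Σ_{i ∉ F, w i ≠ a} ‖b i‖ ‖w i‖`.
(The Borel series of the charges `b i w i` vanishes outside the disc, `ScrewBlaschkeNecessity.hasSum_gen`;
then `shield_mul_charge_le_tail`.) -/
theorem shield_mul_charge_le_tail_of_moments {ι : Type*} [Countable ι] {w b : ι → ℂ}
    (hw : ∀ i, ‖w i‖ < 1) (hb : Summable fun i ↦ ‖b i‖)
    (hmom : ∀ k : ℕ, 1 ≤ k → HasSum (fun i ↦ b i * w i ^ k) 0) (a : ℂ) (F : Finset ι) :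
    (∏ i ∈ F, ‖bl (w i) a‖) * ‖a‖ * ‖∑' i : {i // w i = a}, b i‖ ≤
      ∑' i : {i // i ∉ F ∧ w i ≠ a}, ‖b i‖ * ‖w i‖ := by
  classical
  -- the charges `c i = b i w i` are `ℓ¹` and their Borel series vanishes on `1 < ‖z‖`
  set c : ι → ℂ := fun i ↦ b i * w i with hc
  have hcs : Summable fun i ↦ ‖c i‖ := by
    refine Summable.of_nonneg_of_le (fun i ↦ norm_nonneg _) (fun i ↦ ?_) hb
    simp only [hc, norm_mul]
    exact mul_le_of_le_one_right (norm_nonneg _) (hw i).le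
  have h1 : ((1 : ℝ) : ℂ) ≠ 0 := by simp
  have hblind : ∀ z : ℂ, 1 < ‖z‖ → HasSum (fun i ↦ c i / (z - w i)) 0 := by
    intro z hz
    have hz0 : z ≠ 0 := by
      rintro rfl; rw [norm_zero] at hz; linarith
    have hu : (1 : ℝ) * ‖(((1 : ℝ) : ℂ) * z)⁻¹‖ < 1 := by
      rw [Complex.ofReal_one, one_mul, one_mul, norm_inv]
      exact inv_lt_one_of_one_lt₀ hz
    have hg := ScrewBlaschkeNecessity.hasSum_gen zero_le_one hw hb hmom hu
    convert hg using 1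
    funext i
    rw [ScrewBlaschkeNecessity.term_inv h1 hz0]
    simp only [hc, Complex.ofReal_one, div_one]
  have h := shield_mul_charge_le_tail hw hcs hblind a F
  have hfib : ∀ i : {i // w i = a}, c i = b i * a := fun i ↦ by
    simp only [hc]; rw [i.2]
  have htl : ∀ i : {i // i ∉ F ∧ w i ≠ a}, ‖c i‖ = ‖b i‖ * ‖w i‖ := fun i ↦ by
    simp only [hc, norm_mul]
  rw [tsum_congr hfib, tsum_mul_right, norm_mul, tsum_congr htl] at h
  calc (∏ i ∈ F, ‖bl (w i) a‖) * ‖a‖ * ‖∑' i : {i // w i = a}, b i‖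
      = (∏ i ∈ F, ‖bl (w i) a‖) * (‖∑' i : {i // w i = a}, b i‖ * ‖a‖) := by ring
    _ ≤ ∑' i : {i // i ∉ F ∧ w i ≠ a}, ‖b i‖ * ‖w i‖ := h

/-- **The rigid polygon tower obeys the charge–shielding law.**  In the unit-disc normalisation of the tower
(`ScrewLatticeTower.atom`, positive weights `wt`, all moments `k ≥ 1` vanish: `ScrewLatticeTowerC.hasSum_moment`;
depth `e^{-1/c} ≤ 1/18`, seed order `c K₀ ≥ 2`), every atom `j` and every finite set `F` of atoms satisfy
`Π_{i∈F} ‖bl (atom i) (atom j)‖ · ‖atom j‖ · wt j ≤ Σ_{i ∉ F, atom i ≠ atom j} wt i ‖atom i‖`: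
the weight of an atom, damped by the Blaschke product at it of any finite set of other atoms, is at most the
weight outside that set — the finite, local form of `ScrewBlaschkeNecessity.tower_not_blaschke`. -/
theorem tower_shielding {c : ℝ} (hc : 0 < c) (hx : Real.exp (-(1 / c)) ≤ 1 / 18) {K₀ : ℕ}
    (hK : 2 ≤ c * K₀) (j : ScrewLatticeTower.Idx c K₀) (F : Finset (ScrewLatticeTower.Idx c K₀)) :
    (∏ i ∈ F, ‖bl (ScrewLatticeTower.atom c K₀ i) (ScrewLatticeTower.atom c K₀ j)‖) *
        ‖ScrewLatticeTower.atom c K₀ j‖ * ScrewLatticeTower.wt c K₀ j ≤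
      ∑' i : {i // i ∉ F ∧ ScrewLatticeTower.atom c K₀ i ≠ ScrewLatticeTower.atom c K₀ j},
        ScrewLatticeTower.wt c K₀ i * ‖ScrewLatticeTower.atom c K₀ i‖ := by
  classical
  have hK' : 1 < c * K₀ := by linarith
  have hK1 : 1 ≤ K₀ := by
    by_contra h
    have : K₀ = 0 := by omega
    subst this; simp at hK; linarith
  set w : ScrewLatticeTower.Idx c K₀ → ℂ := ScrewLatticeTower.atom c K₀ with hw_def
  set α : ScrewLatticeTower.Idx c K₀ → ℝ := ScrewLatticeTower.wt c K₀ with hα_def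
  have hlt : ∀ i, ‖w i‖ < 1 := fun i ↦ by
    rw [hw_def, ScrewLatticeTower.norm_atom hc hK']
    exact ScrewLatticeTower.rad_lt_one hc (hK1.trans (ScrewLatticeTower.le_level i))
  have hαpos : ∀ i, 0 < α i := fun i ↦ ScrewLatticeTower.wt_pos hc hK' i
  have hαs : Summable α := ScrewLatticeTower.summable_wt hc hx hK
  have hb : Summable fun i ↦ ‖(α i : ℂ)‖ :=
    hαs.congr fun i ↦ by rw [Complex.norm_real, Real.norm_of_nonneg (hαpos i).le]
  have hmom : ∀ k : ℕ, 1 ≤ k → HasSum (fun i ↦ (α i : ℂ) * w i ^ k) 0 := fun k hk ↦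
    ScrewLatticeTower.hasSum_moment hc hx hK hk
  have h := shield_mul_charge_le_tail_of_moments hlt hb hmom (w j) F
  -- the fibre sum is real and at least `wt j`
  have hsub : Summable fun i : {i // w i = w j} ↦ α i := hαs.subtype _
  have hfib : ∑' i : {i // w i = w j}, (α i : ℂ) = ((∑' i : {i // w i = w j}, α i : ℝ) : ℂ) :=
    (Complex.ofReal_tsum _).symm
  have hge : α j ≤ ∑' i : {i // w i = w j}, α i :=
    hsub.le_tsum ⟨j, rfl⟩ fun i _ ↦ (hαpos i).le
  have hnn : 0 ≤ ∑' i : {i // w i = w j}, α i := tsum_nonneg fun i ↦ (hαpos i).le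
  rw [hfib, Complex.norm_real, Real.norm_of_nonneg hnn] at h
  have htl : ∀ i : {i // i ∉ F ∧ w i ≠ w j}, ‖(α i : ℂ)‖ * ‖w i‖ = α i * ‖w i‖ := fun i ↦ by
    rw [Complex.norm_real, Real.norm_of_nonneg (hαpos i).le]
  rw [tsum_congr htl] at h
  calc (∏ i ∈ F, ‖bl (w i) (w j)‖) * ‖w j‖ * α j
      ≤ (∏ i ∈ F, ‖bl (w i) (w j)‖) * ‖w j‖ * ∑' i : {i // w i = w j}, α i := by gcongr
    _ ≤ ∑' i : {i // i ∉ F ∧ w i ≠ w j}, α i * ‖w i‖ := h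

/-! ## 5. The shielding exponent: a shielded pole has charge tails at least a power of its shields -/

/-- The SHIELDING EXPONENT `κ(a, r₁) = log (1/‖a‖) / log (‖a‖/r₁)` of a pole `a` at a leak radius `r₁ < ‖a‖`
(`= d₁/(δ₁ - d₁)` for `‖a‖ = e^{-d₁ h}`, `r₁ = e^{-δ₁ h}`). -/
def shieldExp (a : ℂ) (r₁ : ℝ) : ℝ := Real.log ‖a‖⁻¹ / Real.log (‖a‖ / r₁)

/-- **SHIELDED ⟹ TAIL ≥ c₀ · SHIELD^(1+κ)** (ζ-free; the `N`-elimination of card §23 (4)).  If the pole `a` is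
SHIELDED at the leak radius `0 < r₁ < ‖a‖` with constant `0 < ε₀ ≤ 1` — for every finite `F` off the fibre of `a`
and every `N`, `r₁^(N+1) ≤ ε₀ ‖a‖^N Π_F ‖bl (w i) a‖` forces `ε₀ ‖a‖^N Π_F ‖bl (w i) a‖ < Σ_{i∉F, w i≠a} ‖b i‖ ‖w i‖^N`
(the negation of `hun` in `cluster_charge_eq_zero_of_unshielded`) — then for EVERY finite `F` off the fibre
`ε₀^(1+κ) · ‖a‖ · (Π_{i∈F} ‖bl (w i) a‖)^(1+κ) < Σ_{i ∉ F, w i ≠ a} ‖b i‖`, `κ = shieldExp a r₁`: the finite Blaschke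
products at a shielded pole are at most a constant times the `1/(1+κ)`-th power of the `ℓ¹` charge tails
(choose `N = ⌈(log (1/ε₀) - log Π_F) / log (‖a‖/r₁)⌉`). -/
theorem tail_gt_of_shielded {ι : Type*} {w b : ι → ℂ} (hw : ∀ i, ‖w i‖ < 1)
    (hb : Summable fun i ↦ ‖b i‖) {a : ℂ} (ha1 : ‖a‖ < 1) {r₁ : ℝ} (hr₁0 : 0 < r₁) (hr₁a : r₁ < ‖a‖)
    {ε₀ : ℝ} (hε₀ : 0 < ε₀) (hε₁ : ε₀ ≤ 1)
    (hsh : ∀ F : Finset ι, (∀ i ∈ F, w i ≠ a) → ∀ N : ℕ,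
      r₁ ^ (N + 1) ≤ ε₀ * (‖a‖ ^ N * ∏ i ∈ F, ‖bl (w i) a‖) →
      ε₀ * (‖a‖ ^ N * ∏ i ∈ F, ‖bl (w i) a‖) < ∑' i : {i // i ∉ F ∧ w i ≠ a}, ‖b i‖ * ‖w i‖ ^ N)
    (F : Finset ι) (hF : ∀ i ∈ F, w i ≠ a) :
    ε₀ ^ (1 + shieldExp a r₁) * ‖a‖ * (∏ i ∈ F, ‖bl (w i) a‖) ^ (1 + shieldExp a r₁) <
      ∑' i : {i // i ∉ F ∧ w i ≠ a}, ‖b i‖ := by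
  classical
  have ha0 : 0 < ‖a‖ := hr₁0.trans hr₁a
  set P : ℝ := ∏ i ∈ F, ‖bl (w i) a‖ with hP
  have hP0 : 0 < P := Finset.prod_pos fun i hi ↦ norm_bl_pos (hw i) ha1 (hF i hi)
  have hP1 : P ≤ 1 :=
    Finset.prod_le_one (fun i _ ↦ norm_nonneg _) fun i _ ↦ norm_bl_le_one (hw i) ha1.le
  -- the two logarithmic scales `Λ = log (‖a‖/r₁) > 0`, `A = log (1/‖a‖) > 0`, and `κ = A/Λ`
  set Λ : ℝ := Real.log (‖a‖ / r₁) with hΛ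
  have hΛ0 : 0 < Λ := Real.log_pos ((one_lt_div hr₁0).2 hr₁a)
  have hΛ' : Λ = Real.log ‖a‖ - Real.log r₁ := by rw [hΛ, Real.log_div ha0.ne' hr₁0.ne']
  set A : ℝ := Real.log ‖a‖⁻¹ with hA
  have hA' : A = -Real.log ‖a‖ := by rw [hA, Real.log_inv]
  have hA0 : 0 < A := by rw [hA']; linarith [Real.log_neg ha0 ha1]
  set κ : ℝ := shieldExp a r₁ with hκdef
  have hκ : κ = A / Λ := rfl
  have hκ0 : 0 ≤ κ := by rw [hκ]; exact div_nonneg hA0.le hΛ0.le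
  have hκΛ : κ * Λ = A := by rw [hκ]; field_simp
  -- `X = log (1/ε₀) - log P ≥ 0` and `N = ⌈X/Λ⌉`
  set X : ℝ := Real.log ε₀⁻¹ - Real.log P with hX
  have hX' : X = -Real.log ε₀ - Real.log P := by rw [hX, Real.log_inv]
  have hX0 : 0 ≤ X := by
    rw [hX']
    linarith [Real.log_nonpos hε₀.le hε₁, Real.log_nonpos hP0.le hP1]
  set N : ℕ := ⌈X / Λ⌉₊ with hN
  have hNge : X / Λ ≤ N := Nat.le_ceil _
  have hNlt : (N : ℝ) < X / Λ + 1 := Nat.ceil_lt_add_one (div_nonneg hX0 hΛ0.le)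
  -- (i) the leak clause holds at `N`: `r₁^(N+1) ≤ r₁^N ≤ ε₀ P ‖a‖^N`
  have h1 : X ≤ N * Λ := by
    have := hNge
    rwa [div_le_iff₀ hΛ0] at this
  have hleakN : r₁ ^ N ≤ ε₀ * P * ‖a‖ ^ N := by
    have hpos : 0 < ε₀ * P * ‖a‖ ^ N := by positivity
    rw [← Real.exp_log (pow_pos hr₁0 N), ← Real.exp_log hpos, Real.exp_le_exp,
      Real.log_mul (mul_pos hε₀ hP0).ne' (pow_pos ha0 N).ne', Real.log_mul hε₀.ne' hP0.ne',
      Real.log_pow, Real.log_pow]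
    rw [hΛ'] at h1
    rw [hX'] at h1
    have h2 : (N : ℝ) * (Real.log ‖a‖ - Real.log r₁) = N * Real.log ‖a‖ - N * Real.log r₁ := by ring
    linarith
  have hleak : r₁ ^ (N + 1) ≤ ε₀ * (‖a‖ ^ N * P) := by
    calc r₁ ^ (N + 1) = r₁ ^ N * r₁ := pow_succ r₁ N
      _ ≤ r₁ ^ N * 1 := mul_le_mul_of_nonneg_left (hr₁a.le.trans ha1.le) (pow_nonneg hr₁0.le N)
      _ ≤ ε₀ * P * ‖a‖ ^ N := by rw [mul_one]; exact hleakN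
      _ = ε₀ * (‖a‖ ^ N * P) := by ring
  -- (ii) shieldedness at `N`
  have htail : ε₀ * (‖a‖ ^ N * P) < ∑' i : {i // i ∉ F ∧ w i ≠ a}, ‖b i‖ * ‖w i‖ ^ N :=
    hsh F hF N hleak
  -- (iii) the `N`-damped tail is at most the `ℓ¹` tail
  have hsT : Summable fun i : {i // i ∉ F ∧ w i ≠ a} ↦ ‖b i‖ := hb.subtype _
  have hle : ∀ i : {i // i ∉ F ∧ w i ≠ a}, ‖b i‖ * ‖w i‖ ^ N ≤ ‖b i‖ := fun i ↦
    mul_le_of_le_one_right (norm_nonneg _) (pow_le_one₀ (norm_nonneg _) (hw i).le)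
  have hTt : ∑' i : {i // i ∉ F ∧ w i ≠ a}, ‖b i‖ * ‖w i‖ ^ N ≤
      ∑' i : {i // i ∉ F ∧ w i ≠ a}, ‖b i‖ :=
    Summable.tsum_le_tsum hle
      (hsT.of_nonneg_of_le (fun i ↦ mul_nonneg (norm_nonneg _) (pow_nonneg (norm_nonneg _) _)) hle)
      hsT
  -- (iv) `N A ≤ κ X + A`, hence `ε₀^(1+κ) ‖a‖ P^(1+κ) ≤ ε₀ ‖a‖^N P`
  have hNA : (N : ℝ) * A ≤ κ * X + A := by
    have h3 : (N : ℝ) * Λ ≤ X + Λ := by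
      have h4 : (N : ℝ) * Λ < (X / Λ + 1) * Λ := mul_lt_mul_of_pos_right hNlt hΛ0
      rw [add_mul, div_mul_cancel₀ X hΛ0.ne', one_mul] at h4
      exact h4.le
    calc (N : ℝ) * A = κ * (N * Λ) := by rw [← hκΛ]; ring
      _ ≤ κ * (X + Λ) := mul_le_mul_of_nonneg_left h3 hκ0
      _ = κ * X + A := by rw [mul_add, hκΛ]
  have e1 : ε₀ ^ (1 + κ) * ‖a‖ * P ^ (1 + κ) =
      Real.exp ((1 + κ) * (Real.log ε₀ + Real.log P) - A) := by
    rw [Real.rpow_def_of_pos hε₀, Real.rpow_def_of_pos hP0, hA']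
    conv_lhs => rw [← Real.exp_log ha0]
    rw [← Real.exp_add, ← Real.exp_add]
    congr 1
    ring
  have e2 : ε₀ * (‖a‖ ^ N * P) = Real.exp (Real.log ε₀ - N * A + Real.log P) := by
    have h5 : ‖a‖ ^ N = Real.exp (-(N * A)) := by
      rw [hA', mul_neg, neg_neg, Real.exp_nat_mul, Real.exp_log ha0]
    rw [h5, Real.exp_add, Real.exp_sub, Real.exp_log hε₀, Real.exp_log hP0, Real.exp_neg,
      div_eq_mul_inv]
    ring
  have hmain : ε₀ ^ (1 + κ) * ‖a‖ * P ^ (1 + κ) ≤ ε₀ * (‖a‖ ^ N * P) := by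
    rw [e1, e2, Real.exp_le_exp]
    rw [hX'] at hNA
    have h6 : κ * (-Real.log ε₀ - Real.log P) = -(κ * Real.log ε₀) - κ * Real.log P := by ring
    have h7 : (1 + κ) * (Real.log ε₀ + Real.log P) =
        Real.log ε₀ + Real.log P + κ * Real.log ε₀ + κ * Real.log P := by ring
    linarith
  calc ε₀ ^ (1 + κ) * ‖a‖ * P ^ (1 + κ) ≤ ε₀ * (‖a‖ ^ N * P) := hmain
    _ < ∑' i : {i // i ∉ F ∧ w i ≠ a}, ‖b i‖ * ‖w i‖ ^ N := htail
    _ ≤ ∑' i : {i // i ∉ F ∧ w i ≠ a}, ‖b i‖ := hTt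

end Summit.RiemannHypothesis.RiemannHypothesis.Theorems.Splittings.ScrewBlaschkeShielding
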